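import Literature.MathematicalPhysics.QuantumFieldTheory.Balaban1983to89.Node00.Record12MeasurabilityHist
import Literature.MathematicalPhysics.QuantumFieldTheory.Balaban1983to89.Node00.Record12MeasurabilityAtLiveRecord
import Literature.MathematicalPhysics.QuantumFieldTheory.Balaban1983to89.Node00.RStepProvisosIntAtRecord
import Literature.MathematicalPhysics.QuantumFieldTheory.Balaban1983to89.Node00.Record12MinimiserSelection

/-!
# NODE 00 — K0′ COMPONENTS G3, FILE 8 (REBALANCE №62 S6, director-ym №128 D1 (B)): (H-U) `LocalBgMeasurable F N ν` IS A THEOREM — def-R's `UminOfRecord` now reads the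
# predicate-fed measurable-selection body (`Node00/SmallFieldChiOfRecord.lean` v2′, p487299) and K0c's determined selector (p483034) inhabits its first branch; rows
# P1 ∕ P2 ∕ P3, (H-ζ), row P6 in the integrable form and the `Provisos`-assemblies of FILE 3 ∕ 6 ∕ 7 with the hypothesis `hU` SUPPLIED — at θ₀ˡⁱᵛᵉ and along any history

Cell `pub-ymgap`, NODE 00, prover seat `pub-ymgap-node00-def-K0c` (g3); K0′ = `stmt-QuantumFields-19902`; CLOSABILITY-GATE rows P1–P3 (`RECORD13-CLOSABILITY-GATE.md`).
[III] = [Balaban1988Convergent], [IV] = [Balaban1989LargeFieldI].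

WHY.  Since g0 (FILE 1 `Node00/Record12Measurability`, p464234) rows P1 ∕ P2 ∕ P3 of `Provisos₁₀ ∕ ₁₂` were theorems MODULO ONE DISPLAYED CLAUSE, (H-U)
`LocalBgMeasurable F N ν` — measurability of the (2.16) local backgrounds over def-R's (2.12) solution datum `bgOfRecord`, whose solution map `UminOfRecord` was a bare
`Classical.choose` (no measurability provable or refutable).  Director-ym LINE №128 D1 ruled route (B): def-R re-pointed `UminOfRecord` IN PLACE (v2′, p487299: first
branch = a measurable PREDICATE-FED selector when one exists — `SelSpec`, `measurable_UminOfRecord_of_selector`; else the v1 body), after K0c's caller probe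
(`UminOfRecordV2Probe`, evidence №9 on 19902) and the three generic-`G` reader binders (S2′ p485547, S4 p486725 ∕ p486740).  K0c v1.1 (p483034) supplies, at `SU(N)`, the
averaging of record, every threshold and every `𝐁_k(□)`, a measurable selector that is moreover DETERMINED by the minimal orbit
(`exists_measurable_isMinimizer_selector_determined_Bj`) — exactly the four hypotheses of `measurable_UminOfRecord_of_selector`.

WHAT THIS FILE PROVES (theorems only).
* §1 `measurable_UminOfRecord (K k δ M₁ □)` : `Measurable (UminOfRecord (avOfRecord F N K) {PlaqSmall δ} (Bj M₁ □ k))`; ★★ **`localBgMeasurable (ν) : LocalBgMeasurable F N ν`**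
  — (H-U) FOR THE DATUM OF RECORD, every numerics `ν`, every `N` (g2's `measurable_ukBox_bgSel` proof, now for `bgOfRecord` itself).
* §2 AT θ₀ˡⁱᵛᵉ OF RECORD, `hU` SUPPLIED (rung A ⟸ P6-supp ∧ P7: FILE 6's `provisos₁₀_theta12LiveOfRecord_of_localBg (localBgMeasurable F N _)`), ★ `rstepInt_theta12LiveOfRecord_abs`
  (def-R FILE 18's P6-INT — NO hypothesis), ★★ `exists_k0prime_of_rstep_contT_bg_theta12Live F (hrstep hcontT hbg)` — the text of `Record12Inhabited` for `F` from EXACTLY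
  THREE displayed rows P6 (support form), P7, P11 (FILE 6's four-row reduction with (H-U) discharged).
* §3 along ANY history ∕ normalisation at a Stage-12 parameter carrying K0b's residuals — the faces `Record13` §4c cites — with NO (H-U) hypothesis:
  `Stage12Params.measChi_hist`, `…measω_of_residuals_hist`, `…intPiece_of_residuals_hist` (FILE 7 with `hU := localBgMeasurable F N θ.ν`).

HONEST FRAMING — what this is NOT.  Kernel measure theory over the tree's own (2.12) datum; rows P6 (support form) ∕ P7 ∕ P11 stay DISPLAYED hypotheses where they
appear; nothing of Bałaban's is asserted ([15] Thm 1 — existence ∕ uniqueness mod gauge of the minimiser — is NOT used: a selector needs neither); K0′ is NOT discharged;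
no node count moves (typed 28∕28 · discharged 5∕28).  One finite four-torus programme at fixed `ε = L^{−K}` — NOT the continuum limit, NOT infinite volume, NOT OS, NOT a
mass gap, NOT the Clay problem.  general-N: every declaration `(N) [NeZero N]` except the one `N = 2` text of 19902.  No `sorry` ∕ `axiom` ∕ `def` ∕ `instance` ∕ `notation`.
-/
noncomputable section

open MeasureTheory
open scoped Matrix.Norms.L2Operator

namespace Literature.MathematicalPhysics.QuantumFieldTheory.Balaban1983to89.Node00

open T4Continuum B14.Eq218Concrete T4AveragingDisintegration T4FiniteEpsInhabited B14.Sect3Decomp B15DeterminingSets B14.Eq213DetSet B14.Eq216Concrete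
open Literature.MathematicalPhysics.QuantumFieldTheory.BalabanImbrieJaffe1984to88.BIJ85Eq453GaugeField (qsstarG qsstarGIter0 qsstarG_apply qsstarGIter0_succ)

variable (F : T4Family) (N : ℕ) [NeZero N]

/-! ## §1. The (2.12) solution map of record is MEASURABLE at every determining set of record; (H-U) is a theorem -/

section HU

/-- The one-step pull-back (1.3) `Q^{s*}` is measurable. [folklore] -/
private theorem measurable_qsstarG' {P : Params} {j : ℕ} {G : Type*} [MeasurableSpace G] [One G] :
    Measurable (qsstarG : GaugeField P (j + 1) G → GaugeField P j G) := by
  refine measurable_pi_iff.mpr fun b => ?_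
  by_cases h : blockOf b.tgt = blockOf b.src
  · simp only [qsstarG_apply, if_pos h]; exact measurable_const
  · simp only [qsstarG_apply, if_neg h]; exact measurable_pi_apply _

/-- `Q^{s*}_k` is measurable. [folklore] -/
private theorem measurable_qsstarGIter0' {P : Params} {G : Type*} [MeasurableSpace G] [One G] :
    ∀ k : ℕ, Measurable (qsstarGIter0 k : GaugeField P k G → GaugeField P 0 G)
  | 0 => measurable_id
  | k + 1 => by
    rw [show (qsstarGIter0 (k + 1) : GaugeField P (k + 1) G → GaugeField P 0 G) = fun V => qsstarGIter0 k (qsstarG V) from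
      funext fun V => qsstarGIter0_succ k V]
    exact (measurable_qsstarGIter0' k).comp measurable_qsstarG'

/-- **THE (2.12) SOLUTION MAP OF RECORD IS MEASURABLE** at `SU(N)`, the averaging of record, every threshold and every `𝐁_k(□)`: def-R's `UminOfRecord` (FILE 1 v2)
prefers a measurable determined selector when one exists, and K0c v1.1's `exists_measurable_isMinimizer_selector_determined_Bj` supplies one.
[cite: Balaban1988Convergent, (2.12)–(2.13) pp.256–257] -/
theorem measurable_UminOfRecord (K k : ℕ) (δ : ℝ) (M₁ : ℕ) (box4 : Set (Site (F.P K) 0)) :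
    Measurable (UminOfRecord (avOfRecord F N K) {U : GaugeField (F.P K) 0 (SU N) | PlaqSmall δ U} (Bj M₁ box4 k)) := by
  obtain ⟨f, hf, hmin, hjunk, hdet⟩ := exists_measurable_isMinimizer_selector_determined_Bj F N K k δ M₁ box4
  exact measurable_UminOfRecord_of_selector _ _ f hf hmin hjunk hdet

/-- **★ (H-U) IS A THEOREM**: every (2.16) local background `V_k ↦ U_{k,□}(V_k) = U(𝐁_k(□), M˙(Q_k^{s*}V_k))` over def-R's datum of record `bgOfRecord` is a measurable map of
the field — `LocalBgMeasurable F N ν`, every numerics `ν`. [cite: Balaban1988Convergent, (2.12) p.256, (2.16) p.257] -/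
theorem localBgMeasurable (ν : Stage7Numerics) : LocalBgMeasurable F N ν := by
  intro K k box4
  have hM : Measurable (avgFamily (avOfRecord F N K) : GaugeField (F.P K) 0 (SU N) → MSField (F.P K) (SU N)) :=
    measurable_pi_lambda _ fun j => measurable_iter (avOfRecord F N K) (avOfRecord_measurable F N K) j
  exact (measurable_UminOfRecord F N K k _ ν.M₁ box4).comp (hM.comp (measurable_qsstarGIter0' k))

end HU

/-! ## §2. Rows P1 ∕ P2 ∕ P3 and row P6 (integrable form) AT θ₀ˡⁱᵛᵉ OF RECORD — NO (H-U) HYPOTHESIS -/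

section AtLive

/- NOTE (gate dedup): rung A at θ₀ˡⁱᵛᵉ modulo P6 (support form) ∧ P7 only is FILE 6's `provisos₁₀_theta12LiveOfRecord_of_localBg (localBgMeasurable F N _) hrstep hcontT`
— the gate identifies the `hU`-free restatement with FILE 6's theorem, so it is not re-declared here; likewise `provisos₁₂_theta12LiveOfRecord_of_localBg (localBgMeasurable F N _) …`. -/

/-- **★ ROW P6 IN THE INTEGRABLE FORM AT θ₀ˡⁱᵛᵉ — NO HYPOTHESIS** (def-R FILE 18 `rstepInt_theta12LiveOfRecord` with `hU` supplied).
[cite: Balaban1989LargeFieldI, (0.3)–(0.4) p.176; Balaban1988Convergent, (2.17)–(2.18) p.257 (bookkeeping)] -/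
theorem rstepInt_theta12LiveOfRecord_abs :
    (theta12LiveOfRecord F N (zeta316OfRecord F N numerics7OfRecord₁₂ 1 1) (RzOfRecord F N) (ZtOfRecord F N)).toStage9Params.RStepInt :=
  rstepInt_theta12LiveOfRecord (localBgMeasurable F N numerics7OfRecord₁₂) (RzOfRecord F N) (ZtOfRecord F N)

/-- **★★ K0′'s TEXT FOR `F` AT `N = 2` FROM EXACTLY THREE NAMED ROWS — P6 (support form), P7, P11 — read at θ₀ˡⁱᵛᵉ** (FILE 6 `exists_k0prime_of_localBg_theta12Live` with
`hU` supplied).  The three rows are DISPLAYED, not asserted; K0′ is NOT discharged. [cite: Balaban1988Convergent, Thm 1 p.262, (3.16)–(3.22) pp.268–269 (bookkeeping)] -/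
theorem exists_k0prime_of_rstep_contT_bg_theta12Live (F : T4Family)
    (hrstep : ∀ (p : B12.RunParams) (k : ℕ) [DecidableEq (PBond (F.P p.K) (k + 1))], k < p.K →
      (towerRepOfRecord F 2 numerics7OfRecord₁₂
          (theta12LiveOfRecord F 2 (zeta316OfRecord F 2 numerics7OfRecord₁₂ 1 1) (RzOfRecord F 2) (ZtOfRecord F 2)).τ9
          (slotsTOfRecord F 2 numerics7OfRecord₁₂
            (theta12LiveOfRecord F 2 (zeta316OfRecord F 2 numerics7OfRecord₁₂ 1 1) (RzOfRecord F 2) (ZtOfRecord F 2)).τ9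
            (EOfRecord₁₀ F 2 (theta12LiveOfRecord F 2 (zeta316OfRecord F 2 numerics7OfRecord₁₂ 1 1) (RzOfRecord F 2) (ZtOfRecord F 2)).toStage9Params)
            (wOfRecord₉ F 2 (theta12LiveOfRecord F 2 (zeta316OfRecord F 2 numerics7OfRecord₁₂ 1 1) (RzOfRecord F 2) (ZtOfRecord F 2)).toStage9Params)
            (theta12LiveOfRecord F 2 (zeta316OfRecord F 2 numerics7OfRecord₁₂ 1 1) (RzOfRecord F 2) (ZtOfRecord F 2)).ppSel)
          (theta12LiveOfRecord F 2 (zeta316OfRecord F 2 numerics7OfRecord₁₂ 1 1) (RzOfRecord F 2) (ZtOfRecord F 2)).ppSel p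
          (gOfRecord₁₀ F 2 (theta12LiveOfRecord F 2 (zeta316OfRecord F 2 numerics7OfRecord₁₂ 1 1) (RzOfRecord F 2) (ZtOfRecord F 2)).toStage9Params p)
          (k + 1)).toRepData.ProvisosSupp)
    (hcontT : (theta12LiveOfRecord F 2 (zeta316OfRecord F 2 numerics7OfRecord₁₂ 1 1) (RzOfRecord F 2) (ZtOfRecord F 2)).toStage8Params.HasContTransportAlong)
    (hbg : ∀ (p : B12.RunParams) (n : ℕ), n ≤ p.K →
      Step.InInterval (1 / 2 : ℝ) n
        (gOfRecord₁₀ F 2 (theta12LiveOfRecord F 2 (zeta316OfRecord F 2 numerics7OfRecord₁₂ 1 1) (RzOfRecord F 2) (ZtOfRecord F 2)).toStage9Params p) →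
      BgProviso F 2 p.K
        (settingOfRecord₁₂ F 2 (theta12LiveOfRecord F 2 (zeta316OfRecord F 2 numerics7OfRecord₁₂ 1 1) (RzOfRecord F 2) (ZtOfRecord F 2)) p)
        (RzOfRecord F 2 p.K) 1 n
        (suppOfRecord₁₂ F 2 (theta12LiveOfRecord F 2 (zeta316OfRecord F 2 numerics7OfRecord₁₂ 1 1) (RzOfRecord F 2) (ZtOfRecord F 2)) p n)
        (UbgOfRecord₁₂ F 2 (theta12LiveOfRecord F 2 (zeta316OfRecord F 2 numerics7OfRecord₁₂ 1 1) (RzOfRecord F 2) (ZtOfRecord F 2)) p n)) :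
    ∃ θ : Stage12Params F 2, θ.Provisos₁₂ F 2 ∧ (θ.ZtUnity F 2 ∧ θ.SlotsNondegenerate) ∧ θ.Admissible F 2 :=
  exists_k0prime_of_localBg_theta12Live F (localBgMeasurable F 2 numerics7OfRecord₁₂) hrstep hcontT hbg

end AtLive

/-! ## §3. Rows P1 ∕ P2 ∕ P3 along ANY history at a Stage-12 parameter with K0b's residuals — NO (H-U) HYPOTHESIS (the faces Record13 §4c cites) -/

section Hist

variable {F N}

/-- **ROW P3 along any history, NO hypothesis.** [cite: Balaban1988Convergent, (2.17)–(2.18) p.257, (3.2) p.265 (bookkeeping)] -/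
theorem Stage12Params.measChi_hist (θ : Stage12Params F N) (g : B12.RunParams → ℕ → ℝ) :
    ∀ (p : B12.RunParams) (k : ℕ), k < p.K → ∀ s' : SeqOfRecord F θ.ν θ.τ9.M (g p) p.K (k + 1),
      Measurable (chiSeqOfRecord F N θ.ν θ.τ9.M (g p) p.K (k + 1) s') :=
  θ.measChi_of_localBg_of_residuals_hist (localBgMeasurable F N θ.ν) g

/-- **ROW P2 along any history at K0b's residuals, NO hypothesis.** [cite: Balaban1988Convergent, (3.2)–(3.5) p.265, (3.16) p.268 (bookkeeping)] -/
theorem Stage12Params.measω_of_residuals_hist (θ : Stage12Params F N) (hres : θ.HasResidualsOfRecord F N) (g : B12.RunParams → ℕ → ℝ) :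
    ∀ (p : B12.RunParams) (k : ℕ), k < p.K → ∀ (s : SeqOfRecord F θ.ν θ.τ9.M (g p) p.K k) (t : LbOfRecord F θ.ν p (g p) k),
      Measurable (fun z : GaugeField (F.P p.K) (k + 1) (SU N) × GaugeField (F.P p.K) k (SU N) =>
        ωOfRecord F N θ.ν θ.τ9.M p (g p) k θ.A₁ θ.ζ s t z.2 z.1) :=
  θ.measω_of_localBg_of_residuals_hist (localBgMeasurable F N θ.ν) hres g

/-- **ROW P1 along any history and normalisation at K0b's residuals, any selector, NO hypothesis.**
[cite: Balaban1988Convergent, (2.18) p.257, (3.24)–(3.25) p.270; Balaban1989LargeFieldI, (0.3)–(0.4) p.176 (bookkeeping)] -/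
theorem Stage12Params.intPiece_of_residuals_hist (θ : Stage12Params F N) (hres : θ.HasResidualsOfRecord F N) (E : B12.RunParams → ℝ)
    (g : B12.RunParams → ℕ → ℝ) :
    ∀ (p : B12.RunParams) (k : ℕ), k < p.K → ∀ s : SeqOfRecord F θ.ν θ.τ9.M (g p) p.K k,
      Integrable (fun U => chiSeqOfRecord F N θ.ν θ.τ9.M (g p) p.K k s U *
        slotsOfRecord F N θ.ν θ.τ9 E (wOfRecord₉ F N θ.toStage9Params) θ.ppSel p (g p) k s U) (fieldMeasure (F.P p.K) k (SU N)) :=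
  θ.intPiece_of_localBg_of_residuals_hist (localBgMeasurable F N θ.ν) hres E g

end Hist

end Literature.MathematicalPhysics.QuantumFieldTheory.Balaban1983to89.Node00

end
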